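import Summits.BirchSwinnertonDyer.BirchSwinnertonDyer.Theorems.ErratumRoadFiveNonSurjCornerHybridMaxSupplyCore
import HarnessLib

/-!
# Route `ErratumRoadFive` (rung K2), crux `NonSurjCorner` (item stmt-BirchSwinnertonDyer-19065), line `Lines/hybrid.lean` (r20 candidate):
# THE TWIN-LOWER SUPPLIES IN CERTIFICATE CURRENCY — per pair, a UNIT-TWIST table (decidable numerics) gives slot 2″
# (cell `bsd-stepL`, seat `bsd-stepL-corner-p1` g18; `--supports stmt-BirchSwinnertonDyer-19065 --as helper`; the door lane B's census would use)

WHY THIS FILE. Slot 2″ of the r20 candidate (`stub_twinLowerSupply57`, glue #22 `…HybridSupplyKeyed`) asks, at a corner pair `(E, p)`, two ∃-supplies: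
(i) `FHTwinLowerSupplyAt W p` — for every even set `T` of multiplicative primes SOME imaginary quadratic `K` (`|d_K| > 4`, `T` inert and prime to `d_K`,
every other bad prime split, `L(E^{(d_K)},1) ≠ 0`) with a globally minimal model `Wd` of the twist and the display
`ord_p (L(Wd,1)/Ω(Wd)) ≤ ord_p #Ш(Wd) + ord_p ∏c(Wd) − 2·ord_p #tors(Wd)`; (ii) the MAX-frame supply — SOME Heegner `K` with `2` split and the twist's
`≥`-half `Typed.MissingLowerBoundAt Wd p`. Both mention `#Ш(Wd)`, which no computation reads; but both are MONOTONE in it: since `ord_p #Ш(Wd) ≥ 0`, the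
display follows from the COMPUTABLE inequality `ord_p (L(Wd,1)/Ω(Wd)) ≤ ord_p ∏c(Wd) − 2·ord_p #tors(Wd)` (exact modular symbols, Tamagawa numbers,
torsion), and the `≥`-half follows from `X11a.ShaAnUnit Wd p` (`#Ш(Wd)_an` a `p`-adic unit — the census bit). So a per-pair TABLE — one field per even
`T` with the valuation inequality, one field with `2` split and a unit `#Ш_an` twist — certifies slot 2″ AT THAT PAIR. This file is that door (pure
bookkeeping; nothing asserted about any curve). Lane B's height census (CERT-TWINMUAN ∕ SERRE tables, `N ≤ 10¹⁰`) already computes such data.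
* §1 `fhTwinLowerDisplay_of_padicValRat_le` — valuation certificate ⟹ the display; `maxTwinLowerHalf_of_shaAnUnit` — unit `#Ш_an` ⟹ the `≥`-half;
* §2 `fhTwinLowerSupplyAt_of_unitTwistTable` — a table (∀ even `T`, a certified frame) ⟹ `FHTwinLowerSupplyAt W p`;
  `maxTwinLowerSupply_of_unitTwistFrame` — one certified `2`-split frame ⟹ the MAX supply;
* §3 `twinLowerSupplyAt_of_certificates` — both ⟹ slot 2″'s body AT THE PAIR.

HONEST FRAMING: FIVE THEOREMS (no definition, no named fact, no `sorry`); bookkeeping doors from DATA binders (never asserted) to the typed supplies; no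
pair is certified here; 19065 NOT closed; BSD is not advanced; T7.
References (locators only): [cite: Miller2011LMS, §1 and Def. 1.1 (arXiv:1010.2431 p. 3)] [cite: FriedbergHoffstein1995, Thm. B (frame shape)]
[cite: HoffsteinLuo1997, Theorem (§1)] [cite: Skinner2016PacificMC, Thm. C (display shape; nothing asserted)].
-/

set_option autoImplicit false
set_option linter.dupNamespace false -- `Summit.BirchSwinnertonDyer.BirchSwinnertonDyer` (summit = problem), tree-wide

noncomputable section

open scoped Classical NumberField

namespace Summit.BirchSwinnertonDyer.BirchSwinnertonDyer.Theorems

open WeierstrassCurve NumberField IsDedekindDomain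
  Literature.NumberTheory.EllipticCurves
  Literature.NumberTheory.EllipticCurves.Rank1Residual
  Literature.NumberTheory.EllipticCurves.Rank1Residual.Typed
  Summit.BirchSwinnertonDyer.Rank1Residual
  Summit.BirchSwinnertonDyer.Rank1Residual.X11b

/-! ### §1 The two monotonicity steps -/

/-- **Valuation certificate ⟹ the twin-lower DISPLAY**: if `L(Wd,1)/Ω(Wd) = q` with `ord_p q ≤ ord_p ∏c(Wd) − 2·ord_p #tors(Wd)` (computable), then
`ord_p q ≤ ord_p #Ш(Wd) + ord_p ∏c(Wd) − 2·ord_p #tors(Wd)` (since `ord_p #Ш(Wd) ≥ 0`). Bookkeeping. [cite: Miller2011LMS, Def. 1.1 (shape)] -/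
theorem fhTwinLowerDisplay_of_padicValRat_le (Wd : WeierstrassCurve ℚ) [Wd.IsElliptic] (p : ℕ) {q : ℚ}
    (hq : Wd.entireLFunction 1 / (Wd.realPeriodRat : ℂ) = (q : ℂ))
    (hv : padicValRat p q ≤ (padicValNat p Wd.tamagawaProduct : ℤ) - 2 * padicValNat p Wd.torsionOrder) :
    ∃ q : ℚ, Wd.entireLFunction 1 / (Wd.realPeriodRat : ℂ) = (q : ℂ) ∧
      padicValRat p q ≤ (padicValNat p Wd.shaOrder : ℤ) + padicValNat p Wd.tamagawaProduct -
        2 * padicValNat p Wd.torsionOrder :=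
  ⟨q, hq, hv.trans (by
    have h0 : (0 : ℤ) ≤ padicValNat p Wd.shaOrder := by exact_mod_cast Nat.zero_le _
    omega)⟩

/-- **Unit `#Ш_an` ⟹ the twin's `≥`-half** (`X11a.ShaAnUnit Wd p → Typed.MissingLowerBoundAt Wd p`): the lower half is trivial at a twist whose
analytic Ш is a `p`-adic unit (the census bit). Bookkeeping. [cite: Miller2011LMS, Def. 1.1 (shape)] -/
theorem maxTwinLowerHalf_of_shaAnUnit (Wd : WeierstrassCurve ℚ) [Wd.IsElliptic] [Wd.IsGloballyMinimal] (p : ℕ) [Fact p.Prime]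
    (h : X11a.ShaAnUnit Wd p) : Typed.MissingLowerBoundAt Wd p := by
  obtain ⟨q, hq, hvq⟩ := h
  exact ⟨q, hq, by rw [hvq]; exact_mod_cast Nat.zero_le _⟩

/-! ### §2 The two supplies from a unit-twist table -/

/-- **A certified Friedberg–Hoffstein TABLE gives `FHTwinLowerSupplyAt W p`**: for every even set `T` of multiplicative primes a field `K` with the
frame conditions, a globally minimal twist model `Wd`, and the COMPUTABLE valuation certificate `ord_p (L(Wd,1)/Ω(Wd)) ≤ ord_p ∏c(Wd) − 2·ord_p #tors(Wd)`
(DATA binders; nothing asserted). Bookkeeping (§1). [cite: FriedbergHoffstein1995, Thm. B (frame shape)] [cite: Miller2011LMS, Def. 1.1] -/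
theorem fhTwinLowerSupplyAt_of_unitTwistTable (W : WeierstrassCurve ℚ) [W.IsElliptic] (p : ℕ)
    (htab : ∀ (T : Finset ℕ), (∀ ℓ ∈ T, ∃ _ : Fact ℓ.Prime, Mult W ℓ) → Even T.card →
      ∃ (K : Type) (_ : Field K) (_ : NumberField K)
        (Wd : WeierstrassCurve ℚ) (_ : Wd.IsElliptic) (_ : Wd.IsGloballyMinimal) (Cd : VariableChange ℚ),
        IsImaginaryQuadratic K ∧ 4 < (NumberField.discr K).natAbs ∧
        (∀ ℓ ∈ T, ((Ideal.span {(ℓ : ℤ)}).primesOver (𝓞 K)).ncard = 1 ∧ ¬ (ℓ : ℤ) ∣ NumberField.discr K) ∧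
        (∀ ℓ : ℕ, ℓ.Prime → ℓ ∣ W.conductorNorm ℤ → ℓ ∉ T →
          ((Ideal.span {(ℓ : ℤ)}).primesOver (𝓞 K)).ncard = 2) ∧
        (W.quadraticTwist (NumberField.discr K : ℚ)).entireLFunction 1 ≠ 0 ∧
        Cd • W.quadraticTwist (NumberField.discr K : ℚ) = Wd ∧
        ∃ q : ℚ, Wd.entireLFunction 1 / (Wd.realPeriodRat : ℂ) = (q : ℂ) ∧
          padicValRat p q ≤ (padicValNat p Wd.tamagawaProduct : ℤ) - 2 * padicValNat p Wd.torsionOrder) :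
    FHTwinLowerSupplyAt W p := by
  intro T hT hTeven
  obtain ⟨K, _, _, Wd, _, _, Cd, hK, hdisc, hinert, hsplit, hLt, hWd, q, hq, hv⟩ := htab T hT hTeven
  exact ⟨K, inferInstance, inferInstance, Wd, inferInstance, inferInstance, Cd, hK, hdisc, hinert, hsplit, hLt, hWd,
    fhTwinLowerDisplay_of_padicValRat_le Wd p hq hv⟩

/-- **One certified `2`-split Heegner frame with a UNIT `#Ш_an` twist gives the MAX-frame supply** (DATA binders; nothing asserted). Bookkeeping (§1).
[cite: HoffsteinLuo1997, Theorem (§1) (frame shape)] [cite: Miller2011LMS, Def. 1.1] -/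
theorem maxTwinLowerSupply_of_unitTwistFrame (W : WeierstrassCurve ℚ) [W.IsElliptic] (p : ℕ) [Fact p.Prime]
    (K : Type) [Field K] [NumberField K] (hK : IsImaginaryQuadratic K) (hdisc : 4 < (NumberField.discr K).natAbs)
    (hHN : SatisfiesHeegnerHypothesis (W.conductorNorm ℤ) K) (hH2 : SatisfiesHeegnerHypothesis 2 K)
    (hLt : (W.quadraticTwist (NumberField.discr K : ℚ)).entireLFunction 1 ≠ 0)
    (hunit : ∀ (Wd : WeierstrassCurve ℚ) [Wd.IsElliptic] [Wd.IsGloballyMinimal] (Cd : VariableChange ℚ),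
      Cd • W.quadraticTwist (NumberField.discr K : ℚ) = Wd → X11a.ShaAnUnit Wd p) :
    ∃ (K : Type) (_ : Field K) (_ : NumberField K), IsImaginaryQuadratic K ∧ 4 < (NumberField.discr K).natAbs ∧
      SatisfiesHeegnerHypothesis (W.conductorNorm ℤ) K ∧ SatisfiesHeegnerHypothesis 2 K ∧
      (W.quadraticTwist (NumberField.discr K : ℚ)).entireLFunction 1 ≠ 0 ∧
      ∀ (Wd : WeierstrassCurve ℚ) [Wd.IsElliptic] [Wd.IsGloballyMinimal] (Cd : VariableChange ℚ),
        Cd • W.quadraticTwist (NumberField.discr K : ℚ) = Wd → ¬ Surj Wd p → Typed.MissingLowerBoundAt Wd p :=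
  ⟨K, inferInstance, inferInstance, hK, hdisc, hHN, hH2, hLt,
    fun Wd _ _ Cd hWd _ ↦ maxTwinLowerHalf_of_shaAnUnit Wd p (hunit Wd Cd hWd)⟩

/-! ### §3 Slot 2″ AT ONE PAIR from the two certificates -/

/-- **Slot 2″ of the r20 candidate AT ONE corner pair from a unit-twist table and one unit `2`-split frame** — the door a per-pair census certificate
uses (its antecedents are decidable numerics: splitting of primes in `K`, `L(E^{(d_K)},1) ≠ 0` and the exact values `L(Wd,1)/Ω(Wd)`, `∏c`, `#tors`,
`#Ш(Wd)_an`). Class-wide the supplies stay OPEN (no unit-twist supply in print at the corner). Bookkeeping; nothing asserted about any curve.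
[cite: FriedbergHoffstein1995, Thm. B] [cite: HoffsteinLuo1997, Theorem (§1)] [cite: Miller2011LMS, Def. 1.1] -/
theorem twinLowerSupplyAt_of_certificates (W : WeierstrassCurve ℚ) [W.IsElliptic] (p : ℕ) [Fact p.Prime]
    (htab : ∀ (T : Finset ℕ), (∀ ℓ ∈ T, ∃ _ : Fact ℓ.Prime, Mult W ℓ) → Even T.card →
      ∃ (K : Type) (_ : Field K) (_ : NumberField K)
        (Wd : WeierstrassCurve ℚ) (_ : Wd.IsElliptic) (_ : Wd.IsGloballyMinimal) (Cd : VariableChange ℚ),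
        IsImaginaryQuadratic K ∧ 4 < (NumberField.discr K).natAbs ∧
        (∀ ℓ ∈ T, ((Ideal.span {(ℓ : ℤ)}).primesOver (𝓞 K)).ncard = 1 ∧ ¬ (ℓ : ℤ) ∣ NumberField.discr K) ∧
        (∀ ℓ : ℕ, ℓ.Prime → ℓ ∣ W.conductorNorm ℤ → ℓ ∉ T →
          ((Ideal.span {(ℓ : ℤ)}).primesOver (𝓞 K)).ncard = 2) ∧
        (W.quadraticTwist (NumberField.discr K : ℚ)).entireLFunction 1 ≠ 0 ∧
        Cd • W.quadraticTwist (NumberField.discr K : ℚ) = Wd ∧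
        ∃ q : ℚ, Wd.entireLFunction 1 / (Wd.realPeriodRat : ℂ) = (q : ℂ) ∧
          padicValRat p q ≤ (padicValNat p Wd.tamagawaProduct : ℤ) - 2 * padicValNat p Wd.torsionOrder)
    (K : Type) [Field K] [NumberField K] (hK : IsImaginaryQuadratic K) (hdisc : 4 < (NumberField.discr K).natAbs)
    (hHN : SatisfiesHeegnerHypothesis (W.conductorNorm ℤ) K) (hH2 : SatisfiesHeegnerHypothesis 2 K)
    (hLt : (W.quadraticTwist (NumberField.discr K : ℚ)).entireLFunction 1 ≠ 0)
    (hunit : ∀ (Wd : WeierstrassCurve ℚ) [Wd.IsElliptic] [Wd.IsGloballyMinimal] (Cd : VariableChange ℚ),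
      Cd • W.quadraticTwist (NumberField.discr K : ℚ) = Wd → X11a.ShaAnUnit Wd p) :
    FHTwinLowerSupplyAt W p ∧
    (∃ (K : Type) (_ : Field K) (_ : NumberField K), IsImaginaryQuadratic K ∧ 4 < (NumberField.discr K).natAbs ∧
      SatisfiesHeegnerHypothesis (W.conductorNorm ℤ) K ∧ SatisfiesHeegnerHypothesis 2 K ∧
      (W.quadraticTwist (NumberField.discr K : ℚ)).entireLFunction 1 ≠ 0 ∧
      ∀ (Wd : WeierstrassCurve ℚ) [Wd.IsElliptic] [Wd.IsGloballyMinimal] (Cd : VariableChange ℚ),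
        Cd • W.quadraticTwist (NumberField.discr K : ℚ) = Wd → ¬ Surj Wd p → Typed.MissingLowerBoundAt Wd p) :=
  ⟨fhTwinLowerSupplyAt_of_unitTwistTable W p htab, maxTwinLowerSupply_of_unitTwistFrame W p K hK hdisc hHN hH2 hLt hunit⟩

end Summit.BirchSwinnertonDyer.BirchSwinnertonDyer.Theorems

end
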